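import Summits.CriticalPhenomena.CardyFormulaZ2.Theorems.CardyFlipRussoVoronoiHubFromSmirnovReduction
import Summits.CriticalPhenomena.CardyFormulaZ2.Theorems.CardyFlipRussoVoronoiHubFromSmirnovStubDelaunayMoebius
import Summits.CriticalPhenomena.CardyFormulaZ2.Theorems.CardyFlipRussoVoronoiHubFromSmirnovStubConformalTransportProfile
import Summits.CriticalPhenomena.CardyFormulaZ2.Theorems.CardyFlipRussoVoronoiHubFromSmirnovStubIdentificationCovariance
import Summits.CriticalPhenomena.CardyFormulaZ2.Theorems.CardyFlipRussoVoronoiHubFromSmirnovStubIdentificationReflection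
import Summits.CriticalPhenomena.CardyFormulaZ2.Theorems.CardyFlipRussoVoronoiHubFromSmirnovInsensitivity
import Summits.CriticalPhenomena.CardyFormulaZ2.Theorems.CardyFlipRussoVoronoiHubFromSmirnovCrossRatioDistortion
import Summits.CriticalPhenomena.CardyFormulaZ2.Theorems.CardyFlipRussoVoronoiHubFromSmirnovInCircleCrossRatio
import Summits.CriticalPhenomena.CardyFormulaZ2.Theorems.CardyFlipRussoVoronoiHubFromSmirnovTupleCount
import Summits.CriticalPhenomena.CardyFormulaZ2.Theorems.CardyFlipRussoVoronoiHubFromSmirnovCocircularCrossRatio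
import Summits.CriticalPhenomena.CardyFormulaZ2.Theorems.CardyFlipRussoVoronoiHubFromSmirnovInsensitivityRemoval
import Summits.CriticalPhenomena.CardyFormulaZ2.Theorems.CardyFlipRussoVoronoiHubFromSmirnovVoidBall
import Summits.CriticalPhenomena.CardyFormulaZ2.Theorems.CardyFlipRussoVoronoiHubFromSmirnovBlackRegionLocal
import Summits.CriticalPhenomena.CardyFormulaZ2.Theorems.CardyFlipRussoVoronoiHubFromSmirnovCrossEventLocal
import Summits.CriticalPhenomena.CardyFormulaZ2.Theorems.CardyFlipRussoVoronoiHubFromSmirnovGridNet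
import Summits.CriticalPhenomena.CardyFormulaZ2.Theorems.CardyFlipRussoVoronoiHubFromSmirnovMoebiusOsculation
import Summits.CriticalPhenomena.CardyFormulaZ2.Theorems.CardyFlipRussoVoronoiHubFromSmirnovDelaunayPivot
import Summits.CriticalPhenomena.CardyFormulaZ2.Theorems.CardyFlipRussoVoronoiHubFromSmirnovMoebiusEquidistant
import Summits.CriticalPhenomena.CardyFormulaZ2.Theorems.CardyFlipRussoVoronoiHubFromSmirnovVoidBallIntensity
import Summits.CriticalPhenomena.CardyFormulaZ2.Theorems.CardyFlipRussoVoronoiHubFromSmirnovVoidNearDisc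
import Summits.CriticalPhenomena.CardyFormulaZ2.Theorems.CardyFlipRussoVoronoiHubFromSmirnovBlackRegionCells
import Summits.CriticalPhenomena.CardyFormulaZ2.Theorems.CardyFlipRussoVoronoiHubFromSmirnovDelaunayImageClearance
import Summits.CriticalPhenomena.CardyFormulaZ2.Theorems.CardyFlipRussoVoronoiHubFromSmirnovTupleProb
import Summits.CriticalPhenomena.CardyFormulaZ2.Theorems.CardyFlipRussoVoronoiHubFromSmirnovVoronoiCellSides
import Summits.CriticalPhenomena.CardyFormulaZ2.Theorems.CardyFlipRussoVoronoiHubFromSmirnovPencilFermat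
import Summits.CriticalPhenomena.CardyFormulaZ2.Theorems.CardyFlipRussoVoronoiHubFromSmirnovPencilTie
import Summits.CriticalPhenomena.CardyFormulaZ2.Theorems.CardyFlipRussoVoronoiHubFromSmirnovCountTail
import Summits.CriticalPhenomena.CardyFormulaZ2.Theorems.CardyFlipRussoVoronoiHubFromSmirnovDefectPotential
import Summits.CriticalPhenomena.CardyFormulaZ2.Theorems.CardyFlipRussoVoronoiHubFromSmirnovClosePair
import Summits.CriticalPhenomena.CardyFormulaZ2.Theorems.CardyFlipRussoVoronoiHubFromSmirnovNavelTie
import Summits.CriticalPhenomena.CardyFormulaZ2.Theorems.CardyFlipRussoVoronoiHubFromSmirnovCellNoVoid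
import Summits.CriticalPhenomena.CardyFormulaZ2.Theorems.CardyFlipRussoVoronoiHubFromSmirnovBlackPathChain
import Summits.CriticalPhenomena.CardyFormulaZ2.Theorems.CardyFlipRussoVoronoiHubFromSmirnovGeneralPosition
import Summits.CriticalPhenomena.CardyFormulaZ2.Theorems.CardyFlipRussoVoronoiHubFromSmirnovInsertMono
import Summits.CriticalPhenomena.CardyFormulaZ2.Theorems.CardyFlipRussoVoronoiHubFromSmirnovConvexCell
import Summits.CriticalPhenomena.CardyFormulaZ2.Theorems.CardyFlipRussoVoronoiHubFromSmirnovCellInterior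
import Literature.Analysis.FunctionSpaces.PoissonPointProcessExistence
import Literature.Analysis.FunctionSpaces.PoissonMappingHomeomorph
import Literature.Probability.LatticeModels.DelaunayGraph
import Summits.CriticalPhenomena.CardyFormulaZ2.Theorems.CardyFlipRussoVoronoiHubFromSmirnovImageCrossing
import Summits.CriticalPhenomena.CardyFormulaZ2.Theorems.CardyFlipRussoVoronoiHubFromSmirnovTransportIntensity
import Summits.CriticalPhenomena.CardyFormulaZ2.Theorems.CardyFlipRussoVoronoiHubFromSmirnovTransportCoupling
import Summits.CriticalPhenomena.CardyFormulaZ2.Theorems.CardyFlipRussoVoronoiHubFromSmirnovNoVoid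
import Summits.CriticalPhenomena.CardyFormulaZ2.Theorems.CardyFlipRussoVoronoiHubFromSmirnovGraphDefs
import Summits.CriticalPhenomena.CardyFormulaZ2.Theorems.CardyFlipRussoVoronoiHubFromSmirnovHoloUniformBounds
import Summits.CriticalPhenomena.CardyFormulaZ2.Theorems.CardyFlipRussoVoronoiHubFromSmirnovHNearest
import Summits.CriticalPhenomena.CardyFormulaZ2.Theorems.CardyFlipRussoVoronoiHubFromSmirnovAttachmentImage
import Summits.CriticalPhenomena.CardyFormulaZ2.Theorems.CardyFlipRussoVoronoiHubFromSmirnovGraphRestrict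
import Summits.CriticalPhenomena.CardyFormulaZ2.Theorems.CardyFlipRussoVoronoiHubFromSmirnovMeasurableGraphCross
import Summits.CriticalPhenomena.CardyFormulaZ2.Theorems.CardyFlipRussoVoronoiHubFromSmirnovCrossSubsetGraph
import Summits.CriticalPhenomena.CardyFormulaZ2.Theorems.CardyFlipRussoVoronoiHubFromSmirnovGraphLaw
import Summits.CriticalPhenomena.CardyFormulaZ2.Theorems.CardyFlipRussoVoronoiHubFromSmirnovCrossLeGraph
import Summits.CriticalPhenomena.CardyFormulaZ2.Theorems.CardyFlipRussoVoronoiHubFromSmirnovChainAlongSegment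
import Summits.CriticalPhenomena.CardyFormulaZ2.Theorems.CardyFlipRussoVoronoiHubFromSmirnovPivotalRecolour
import Summits.CriticalPhenomena.CardyFormulaZ2.Theorems.CardyFlipRussoVoronoiHubFromSmirnovUnionLaw
import Literature.Analysis.FunctionSpaces.PoissonFKG
import Literature.Probability.Percolation.VoronoiArmEstimates
import Literature.Analysis.FunctionSpaces.PoissonHarrisFKG
import Literature.Analysis.FunctionSpaces.PoissonRestrictionIndependence
import Summits.CriticalPhenomena.CardyFormulaZ2.Theorems.CardyFlipRussoVoronoiHubFromSmirnovGraphTransportCore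

/-!
# Line `moebius-exact-delaunay-dilation-ward` for the crux `CardyFlipRusso.VoronoiHubFromSmirnov`
(item stmt-CriticalPhenomena-6433, route `CardyFlipRusso`, rank 4) — CHECKED SKELETON (leads a1 → c1 → c2 → c3)

The crux: Smirnov's theorem (`hasCrossingLimit_triDomainCrossingProb`, PROVED in tree) implies
Cardy's formula for annealed Poisson–Voronoi percolation — for two independent Poisson processes
`PB`, `PW` of Lebesgue intensity (black / white nuclei, rescaled by the mesh `δ`) and every conformal
rectangle `R`, the probability of a black continuum crossing of `closure Ω` from the arc `(ab)` to the
arc `(cd)` tends to `cardyFunction η(R)`.  The antecedent is proved and idle, so the item is its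
consequent (Benjamini–Schramm 1998, the conjecture of p. 77 / §10).

## Structure of the reduction (everything below the stubs is a real proof; all named pieces LANDED)

`VoronoiHubFromSmirnov_of_line : S2′ → S3 → S4 → crux` (Reduction module, p125078; Rényi uniqueness
identifies `PB`, `PW` with `poissonLaw volume`, `densityBlind_of` integrates the landed Mecke–Russo
identity S1 against the Ward bound S2′, `conformalNull_of` adds the transport S3, sequential
compactness turns the identification S4 of cluster values into the limit).  Lead c3 SPLIT and RE-CUT
the transport:

* S3 `Sig.stub_conformalTransport` = S3a `Sig.stub_transportCoupling` (PROVED, p154705: Kingman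
  mapping + restriction + Rényi + locality, through the intermediate event `hCrossEvent`) ∧ S3b
  `Sig.stub_transportHeart`, glue `conformalTransport_of` below;
* S3b = S3b-i `Sig.stub_graphTransport` (Benjamini–Schramm Thm 2.1 PROPER in graph form: Euclidean vs
  pulled-back Delaunay-chain crossings `graphCross` / `hGraphCross` of the SAME nuclei, metric-free
  `√δ`-collar attachments — OPEN in tree) ∧ S3b-ii `Sig.stub_graphVsContinuum` (continuum crossing ≈
  graph crossing: the Jordan boundary layer, i.e. the RSW content — OPEN in tree; its easy half
  `crossProb_le_graphCross_eventually` PROVED, p158230) ∧ S3b-iii `Sig.stub_graphLaw` (exact law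
  identity for graph events — PROVED, p158157) ∧ bricks `Sig.stub_graphRestrict` (PROVED, p157545),
  `Sig.stub_attachmentImage` (PROVED, p157448), glue `transportHeart_of` below (S3b-ii is used twice:
  on `R` with the profile `ρ` and on `h • R` with the homogeneous profile and the transported families).

Registered stubs (the `sorry`s of this file): S2′ `stub_wardBound` (Benjamini–Schramm's
Density-Invariance Conjecture 10.1 in Ward form — an OPEN PROBLEM since 1998), S3b-i
`stub_graphTransport` (published, XL: needs FKG for Poisson FUNCTIONALS — named fact
`IsPoissonPointProcess.harrisFKG`, its count layer proved — a marking theorem for `lawBW`, and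
BS98 §§7/9; deterministic core landed: `defect_implies_potentialDefect`, `graphCross_pivotal_recolour`,
`delaunayChain_along_segment`, …), S3b-ii `stub_graphVsContinuum` (needs Voronoi RSW / one-arm decay
for admissible inhomogeneous intensities, Tassion 2016 adapted; truth for positive-area Jordan
boundaries unclear), S4 `stub_identification` (the SLE₆ identification programme for Voronoi with CI
as input; pooled with stmt-0746 / stmt-14293).  Vocabulary: Defs module (p121810 + c3 append
p153733) and GraphDefs module (p155860).  The import check at the end lists every landed brick.

Disproof honoured: none exists for this crux (`ledger crux ls`: no `Disproof.lean`, no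
`Theorems/VoronoiHubFromSmirnov/Negative/`; re-checked 2026-08-17T12:30Z).  Dead line avoided:
`Lines/Sketch.lean` died at a stub equal to the consequent; here no stub speaks about the
homogeneous crossing limit alone.
-/

noncomputable section

namespace Summit.CriticalPhenomena.CardyFormulaZ2.Cruxes.VoronoiHubFromSmirnov.MoebiusExactDelaunayDilationWard

open scoped Topology ENNReal Interval
open Filter Set MeasureTheory
open Literature.Analysis.FunctionSpaces
open Literature.Probability.RandomPlanarGeometry

/-! ### Stubs (registered; `sorry` only here)

S0 (measurability of the crossing event), S1 (Mecke–Russo), the integrability half of S2, the profile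
clause of S3, S3a, S3b-iii and the two S3b bricks are THEOREMS (imported); what remains is S2′,
S3b-i, S3b-ii, S4 — see the module docstring. -/

/-- STUB S2′ (hardest, the kernel): the Ward bound = Benjamini–Schramm Conj. 10.1, differential form. -/
theorem stub_wardBound : Sig.stub_wardBound := by
  sorry

/-- STUB S3b-i′ (lead c3 re-plan, 2026-08-17): TASSION'S ONE-ARM DECAY — the named Literature fact
`VoronoiAnnealedOneArm` (Tassion 2016, Thm 3 (2), annealed mesh-uniform form, for two independent
Poisson processes of Lebesgue intensity = the line's homogeneous law), a registered DEBT of the line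
exactly like S2′: proving it is formalising Tassion's paper. -/
theorem stub_voronoiOneArm : Literature.Probability.Percolation.VoronoiAnnealedOneArm := by
  sorry

/-- S3b-i: GRAPH TRANSPORT — Benjamini–Schramm Thm 2.1 proper, graph form — from the LANDED core
`stub_graphTransportCore` (module `…GraphTransportCore`: the one-arm route in the image domain, lead c3)
and the one-arm named fact (no `sorry` here any more). -/
theorem stub_graphTransport : Sig.stub_graphTransport :=
  stub_graphTransportCore stub_voronoiOneArm

/-- STUB S3b-ii: GRAPH vs CONTINUUM — the Jordan boundary layer, RSW content (lead c3 re-cut). -/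
theorem stub_graphVsContinuum : Sig.stub_graphVsContinuum := by
  sorry

/-! ### Glue of the S3b re-cut (lead c3, 2026-08-17): S3b-i + S3b-ii (twice) + S3b-iii + bricks + S3a ⇒ S3b -/

/-- `c √δ → 0` as `δ → 0⁺`. -/
theorem tendsto_const_mul_sqrt (c : ℝ) :
    Tendsto (fun δ : ℝ => c * Real.sqrt δ) (𝓝[>] 0) (𝓝 0) := by
  have h1 : Tendsto Real.sqrt (𝓝 (0 : ℝ)) (𝓝 0) := by
    simpa using Real.continuous_sqrt.tendsto 0
  have h2 : Tendsto (fun δ : ℝ => c * Real.sqrt δ) (𝓝 0) (𝓝 0) := by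
    simpa using h1.const_mul c
  exact h2.mono_left nhdsWithin_le_nhds

/-- An open, bounded neighbourhood `V₀` of the compact `closure Ω` with `closure V₀ ⊆ U`. -/
theorem exists_open_bounded_between (R : ConformalRectangle) {U : Set ℂ} (hU : IsOpen U)
    (hRU : closure R.carrier ⊆ U) :
    ∃ V₀ : Set ℂ, IsOpen V₀ ∧ Bornology.IsBounded V₀ ∧ closure R.carrier ⊆ V₀ ∧ closure V₀ ⊆ U := by
  obtain ⟨L, hL, hKL, hLU⟩ := exists_compact_between R.isBounded.isCompact_closure hU hRU
  refine ⟨interior L, isOpen_interior, hL.isBounded.subset interior_subset, hKL, ?_⟩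
  exact (closure_minimal interior_subset hL.isClosed).trans hLU

/-- Truncated standard carrier family: the `√δ`-collar of `closure Ω` cut to an open neighbourhood
`V₁` (eventually the cut is vacuous). -/
theorem isDomainFamily_thickening_inter (R : ConformalRectangle) {V₁ : Set ℂ} (hV₁ : IsOpen V₁)
    (hΩV₁ : closure R.carrier ⊆ V₁) :
    IsDomainFamily R fun δ => Metric.thickening (Real.sqrt δ) (closure R.carrier) ∩ V₁ := by
  obtain ⟨ε, hε, hεV⟩ := R.isBounded.isCompact_closure.exists_thickening_subset_open hV₁ hΩV₁
  have hsmall : ∀ᶠ δ : ℝ in 𝓝[>] 0, Real.sqrt δ < ε := by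
    have ht : Tendsto (fun δ : ℝ => Real.sqrt δ) (𝓝[>] 0) (𝓝 0) := by
      simpa using tendsto_const_mul_sqrt 1
    exact (tendsto_order.1 ht).2 ε hε
  refine ⟨1, 1, one_pos, le_rfl, ?_⟩
  filter_upwards [hsmall] with δ hδε
  refine ⟨Metric.isOpen_thickening.measurableSet.inter hV₁.measurableSet, ?_, ?_⟩
  · rw [one_mul]
    exact Set.subset_inter Set.Subset.rfl ((Metric.thickening_mono hδε.le _).trans hεV)
  · rw [one_mul]
    exact Set.inter_subset_left

/-- Truncated standard attachment family of an arc. -/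
theorem isAttachment_thickening_inter (R : ConformalRectangle) (i : Fin 4) {V₁ : Set ℂ}
    (hV₁ : IsOpen V₁) (hΩV₁ : closure R.carrier ⊆ V₁) :
    IsAttachment R i fun δ => Metric.thickening (Real.sqrt δ) (R.arc i) ∩ V₁ := by
  obtain ⟨ε, hε, hεV⟩ := R.isBounded.isCompact_closure.exists_thickening_subset_open hV₁ hΩV₁
  have hsmall : ∀ᶠ δ : ℝ in 𝓝[>] 0, Real.sqrt δ < ε := by
    have ht : Tendsto (fun δ : ℝ => Real.sqrt δ) (𝓝[>] 0) (𝓝 0) := by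
      simpa using tendsto_const_mul_sqrt 1
    exact (tendsto_order.1 ht).2 ε hε
  have harc : R.arc i ⊆ closure R.carrier :=
    (MarkedDomain.arc_subset_frontier R i).trans frontier_subset_closure
  refine ⟨1, 1, one_pos, le_rfl, ?_⟩
  filter_upwards [hsmall] with δ hδε
  refine ⟨Metric.isOpen_thickening.measurableSet.inter hV₁.measurableSet, ?_, ?_⟩
  · rw [one_mul]
    exact Set.subset_inter Set.Subset.rfl (((Metric.thickening_mono hδε.le _).trans
      (Metric.thickening_subset_of_subset _ harc)).trans hεV)
  · rw [one_mul]
    exact Set.inter_subset_left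

/-- **THE S3b GLUE.**  S3b (`Sig.stub_transportHeart`) from: S3b-ii on `R` (profile `ρ`) and on
`h • R` (profile `1`, conformal-image families), S3b-i, the exact law identity S3b-iii, the
locality brick, the family-transport brick, and the LANDED coupling S3a (`stub_transportCoupling`,
p154705): a signed sum of six `o(1)` / exact pieces. -/
theorem transportHeart_of (hi_ : Sig.stub_graphTransport) (hii : Sig.stub_graphVsContinuum)
    (hiii : Sig.stub_graphLaw) (hloc : Sig.stub_graphRestrict) (hatt : Sig.stub_attachmentImage) :
    Sig.stub_transportHeart := by
  intro R h U hU hRU hd hi V hV hVb hΩV hVU ρ hρ hρV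
  -- an intermediate open bounded window `V₁`: closure Ω ⊆ V₁, closure V₁ ⊆ V
  obtain ⟨V₁, hV₁o, hV₁b, hΩV₁, hV₁V⟩ := exists_open_bounded_between R hV hΩV
  have hV₁V' : V₁ ⊆ V := subset_closure.trans hV₁V
  -- standard families on `R`, truncated to `V₁`, and their images on `S = h • R`
  set K : ℝ → Set ℂ := fun δ => Metric.thickening (Real.sqrt δ) (closure R.carrier) ∩ V₁ with hK
  set A : Fin 4 → ℝ → Set ℂ := fun i δ => Metric.thickening (Real.sqrt δ) (R.arc i) ∩ V₁ with hA
  have hKf : IsDomainFamily R K := isDomainFamily_thickening_inter R hV₁o hΩV₁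
  have hA0 : IsAttachment R 0 (A 0) := isAttachment_thickening_inter R 0 hV₁o hΩV₁
  have hA2 : IsAttachment R 2 (A 2) := isAttachment_thickening_inter R 2 hV₁o hΩV₁
  set S : ConformalRectangle := R.imageUnivalent h (hd.mono hRU) (hi.mono hRU) with hS
  obtain ⟨hattA, hattK⟩ := hatt R h U hU hRU hd hi
  have hA0' : IsAttachment S 0 fun δ => h '' A 0 δ := hattA 0 (A 0) hA0
  have hA2' : IsAttachment S 2 fun δ => h '' A 2 δ := hattA 2 (A 2) hA2
  have hKf' : IsDomainFamily S fun δ => h '' K δ := hattK K hKf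
  have hopen : IsOpen (h '' V) :=
    isOpen_image_of_injOn_closure hV (hd.continuousOn.mono hVU) (hi.mono hVU)
  have hcV₁c : IsCompact (closure V₁) :=
    Metric.isCompact_of_isClosed_isBounded isClosed_closure hV₁b.closure
  have hV₁U : closure V₁ ⊆ U := hV₁V.trans (subset_closure.trans hVU)
  have hKc : IsCompact (h '' closure V₁) := hcV₁c.image_of_continuousOn (hd.continuousOn.mono hV₁U)
  have hKW : h '' closure V₁ ⊆ h '' V := Set.image_mono hV₁V
  have harcK : ∀ i δ, A i δ ⊆ K δ := fun i δ =>
    Set.inter_subset_inter_left _ (Metric.thickening_subset_of_subset _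
      ((MarkedDomain.arc_subset_frontier R i).trans frontier_subset_closure))
  have hKV₁ : ∀ δ, K δ ⊆ V₁ := fun δ => Set.inter_subset_right
  have hmK : ∀ δ, MeasurableSet (K δ) := fun δ =>
    Metric.isOpen_thickening.measurableSet.inter hV₁o.measurableSet
  have hmA : ∀ i δ, MeasurableSet (A i δ) := fun i δ =>
    Metric.isOpen_thickening.measurableSet.inter hV₁o.measurableSet
  -- (1) continuum vs graph on `R`, profile `ρ`
  have h1 := hii ρ hρ R K (A 0) (A 2) hKf hA0 hA2
  -- (2) graph transport on `R`
  have h2 := hi_ R h U hU hRU hd hi V hV hVb hΩV hVU ρ hρ hρV K (A 0) (A 2) hKf hA0 hA2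
  -- (4) locality of the homogeneous graph event on the image side
  have h4 := hloc (h '' closure V₁) (h '' V) hKc hopen hKW (fun δ => h '' K δ) (fun δ => h '' A 0 δ)
    (fun δ => h '' A 2 δ) (fun δ => Set.image_mono ((hKV₁ δ).trans subset_closure))
  -- (5) continuum vs graph on `S`, homogeneous profile, image families
  have h5 := hii (fun _ => (1 : ℝ)) admissibleDensity_one S (fun δ => h '' K δ) (fun δ => h '' A 0 δ)
    (fun δ => h '' A 2 δ) hKf' hA0' hA2'
  -- (6) the landed coupling S3a
  have h6 := stub_transportCoupling R h U hU hRU hd hi V hV hVb hΩV hVU ρ hρ hρV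
  -- (3) the exact law identity at every `δ > 0`
  have h3 : ∀ δ : ℝ, 0 < δ →
      (lawBW (intensity ρ 1 δ)).real (hGraphCross (K δ) (A 0 δ) (A 2 δ) h V δ) =
        (lawBW (volume : Measure ℂ)).real
          {c | (PointConfig.restrict {b : ℂ | (δ : ℂ) * b ∈ h '' V} c.1,
            PointConfig.restrict {b : ℂ | (δ : ℂ) * b ∈ h '' V} c.2) ∈
            graphCross (h '' K δ) (h '' A 0 δ) (h '' A 2 δ) δ} := fun δ hδ =>
    hiii R h U hU hRU hd hi V hV hVb hΩV hVU ρ hρ hρV (K δ) (A 0 δ) (A 2 δ) δ hδ (hmK δ) (hmA 0 δ)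
      (hmA 2 δ) ((hKV₁ δ).trans hV₁V') (harcK 0 δ) (harcK 2 δ)
  -- assemble: the target difference is a signed sum of the six pieces
  have hsum := (((h1.neg.add h2.neg).add h4.neg).add h5).add h6.neg
  simp only [neg_zero, add_zero] at hsum
  refine hsum.congr' ?_
  filter_upwards [self_mem_nhdsWithin] with δ hδ
  simp only [crossProb_const_one, intensity_const_one, ← hS]
  rw [h3 δ hδ]
  unfold homCrossProb
  ring

/-- S3b from its re-cut (all five inputs are registered stubs). -/
theorem stub_transportHeart : Sig.stub_transportHeart :=
  transportHeart_of stub_graphTransport stub_graphVsContinuum stub_graphLaw stub_graphRestrict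
    stub_attachmentImage

/-! ### Glue of the S3 split (lead c3, 2026-08-17): S3a + S3b ⇒ S3 -/

/-- **S3a + S3b ⇒ S3** (`Sig.stub_conformalTransport`): choose a bounded open `V` between
`closure Ω` and `U` on which the landed admissible profile equals `‖h′‖²`
(`exists_admissibleDensity_eq_norm_deriv_sq`), and add the two `o(1)` statements. -/
theorem conformalTransport_of (hA : Sig.stub_transportCoupling) (hB : Sig.stub_transportHeart) :
    Sig.stub_conformalTransport := by
  intro R h U hU hRU hd hi
  obtain ⟨V₀, hV₀o, hV₀b, hΩV₀, hV₀U⟩ := exists_open_bounded_between R hU hRU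
  have hV₀U' : V₀ ⊆ U := subset_closure.trans hV₀U
  obtain ⟨ρ, hρ, V₁, hV₁o, hΩV₁, hρV₁⟩ :=
    exists_admissibleDensity_eq_norm_deriv_sq R h V₀ hV₀o hΩV₀ (hd.mono hV₀U') (hi.mono hV₀U')
  set V : Set ℂ := V₀ ∩ V₁ with hV
  have hVo : IsOpen V := hV₀o.inter hV₁o
  have hVb : Bornology.IsBounded V := hV₀b.subset Set.inter_subset_left
  have hΩV : closure R.carrier ⊆ V := Set.subset_inter hΩV₀ hΩV₁
  have hVU : closure V ⊆ U := (closure_mono Set.inter_subset_left).trans hV₀U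
  have hρV : ∀ z ∈ V, ρ z = ‖deriv h z‖ ^ 2 := fun z hz => hρV₁ z hz.2
  refine ⟨ρ, hρ, ⟨V, hVo, hΩV, hρV⟩, ?_⟩
  have h1 := hA R h U hU hRU hd hi V hVo hVb hΩV hVU ρ hρ hρV
  have h2 := hB R h U hU hRU hd hi V hVo hVb hΩV hVU ρ hρ hρV
  have h12 := h1.add h2
  rw [add_zero] at h12
  refine h12.congr' (Eventually.of_forall fun δ => ?_)
  simp only
  ring

/-- S3 from its two halves: the LANDED coupling S3a (`stub_transportCoupling`, p154705) and the
registered heart S3b. -/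
theorem stub_conformalTransport : Sig.stub_conformalTransport :=
  conformalTransport_of stub_transportCoupling stub_transportHeart

/-- STUB S4: identification of conformally invariant subsequential crossing limits. -/
theorem stub_identification : Sig.stub_identification := by
  sorry

/-! ### The composition: the stubs give the crux BY NAME -/

/-- **The crux `VoronoiHubFromSmirnov`** (route CardyFlipRusso, stmt-CriticalPhenomena-6433), BY NAME,
from the three (sorried) stubs S2′, S3, S4 through the landed reduction `VoronoiHubFromSmirnov_of_line`
— the skeleton closes once they are proved. -/
theorem VoronoiHubFromSmirnov_proof :
    Summit.CriticalPhenomena.CardyFormulaZ2.Theses.CardyFlipRusso.VoronoiHubFromSmirnov :=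
  VoronoiHubFromSmirnov_of_line stub_wardBound stub_conformalTransport stub_identification

/-- Import check: everything the open stubs' proof plans lean on that the line has landed or the tree
proves is available under these names. -/
example : True := by
  have _h₀ := @stub_measurableCrossEvent
  have _h₁ := @stub_meckeRusso
  have _h₂ := @integrable_weight_mul_insResp
  have _h₃ := @exists_admissibleDensity_eq_norm_deriv_sq
  have _h₄ := @homCrossProb_imageUnivalent_mul
  have _h₅ := @SketchLine.stub_delaunayEdgeMoebius
  have _h₆ := @Literature.Probability.LatticeModels.isDelaunayPair_inversion_iff ℂ _ _
  have _h₇ := @IsPoissonPointProcess.multivariateMecke_holds.{0}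
  have _h₈ := @IsPoissonPointProcess.mapHomeomorph'.{0, 0}
  have _h₉ := @existsUnique_isPoissonPointProcess_holds.{0}
  -- S3 bricks landed by lead c2, wave 1 (BS98 §8 Lemma 8.1, §4 Lemma 4.1 planar / CR form,
  -- in-circle test as a cross-ratio sign, §5 Lemma 5.2 via the multivariate Mecke equation):
  have _h₁₀ := @insensitivity_unionLaw
  have _h₁₁ := @crossRatio_holomorphic_distortion
  have _h₁₂ := @inCircle_iff_crossRatio_im
  have _h₁₃ := @poisson_tupleCount_lintegral_eq
  -- lead c2, wave 2 (cocircular ⇔ real cross-ratio; BS98 Cor 8.2; BS98 Lemma 5.5 core (void balls);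
  -- locality of the Voronoi colouring):
  have _h₁₄ := @cocircular_iff_crossRatio_real
  have _h₁₅ := @insensitivity_sdiffLaw
  have _h₁₆ := @poisson_voidBall_unionBound
  have _h₁₇ := @blackRegion_inter_eq_of_local
  -- lead c2, wave 3 (locality of `crossEvent`; explicit grid nets; BS98 Lemma 4.1 planar metric form
  -- via the osculating Möbius map; Delaunay pivoting to a third site):
  have _h₁₈ := @crossEvent_iff_of_local
  have _h₁₉ := @exists_finset_net_closedBall
  have _h₂₀ := @moebius_osculation_circle
  have _h₂₁ := @delaunay_pivot_exists_third
  -- lead c2, wave 4 (BS98 Lemma 4.1 (2)–(3) exact equidistant re-centring; void balls for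
  -- intensities ≥ m₀·Lebesgue; assembled no-giant-cells bound; black region = black cells):
  have _h₂₂ := @moebius_osculation_equidistant
  have _h₂₃ := @poisson_voidBall_unionBound_of_le_intensity
  have _h₂₄ := @poisson_voidNear_disc_le
  have _h₂₅ := @mem_blackRegion_iff_exists_voronoiCell
  -- lead c2, wave 5 (BS98 Lemma 4.2 core: clearance ⇒ image Delaunay pair; Lemma 5.2 probability
  -- form; bounded cells see sites on both sides of every line):
  have _h₂₆ := @isDelaunayPair_image_of_clearance
  have _h₂₇ := @poisson_exists_tuple_le_pi
  have _h₂₈ := @exists_site_left_of_voronoiCell_bounded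
  -- lead c2, waves 6–7 (BS98 Lemma 4.2 planar, COMPLETE: pencil Fermat case, pencil tie-or-max,
  -- assembled `defect_implies_potentialDefect`; BS98 §5 rarity by discretised navels: Poisson count
  -- tail, close pairs rare, near-tied navels rare):
  have _h₂₉ := @pencil_localMax_dist_eq
  have _h₃₀ := @pencil_tie_or_localMax
  have _h₃₁ := @poisson_count_tail_le
  have _h₃₂ := @defect_implies_potentialDefect
  have _h₃₃ := @poisson_closePair_le
  have _h₃₄ := @poisson_navelTie_le
  -- lead c2, wave 8 (cells are small where there are no voids; black path ⇒ finite chain of black cells):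
  have _h₃₅ := @voronoiCell_subset_closedBall_of_noVoid
  have _h₃₆ := @blackPath_cellChain
  -- lead c2, wave 9 (a.s. general position: no cocircular/collinear quadruple; the crossing event is
  -- black-increasing a.s., so insResp = (gain ≥ 0) + (loss ≤ 0)):
  have _h₃₇ := @poisson_ae_noCocircularFour
  have _h₃₈ := @crossProb_insert_mono
  -- lead c2, wave 10 (basic Voronoi API: cells convex; interior = strict inequalities):
  have _h₃₉ := @convex_voronoiCell
  have _h₄₀ := @interior_voronoiCell_eq
  -- lead c3, wave 1 (S3a bricks: crossings of image rectangles pull back under embeddings of the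
  -- closure; change of variables ‖h′‖² for the transported intensity):
  have _h₄₁ := @image_crossing_iff_preimage
  have _h₄₂ := @map_transport_intensity_eq
  -- lead c3, wave 1 (cont.): locality of the homogeneous crossing event under restriction; no giant
  -- cells for admissible inhomogeneous intensities; S3a itself (the transport coupling, LANDED):
  have _h₄₃ := @homCrossProb_restrict_tendsto
  have _h₄₄ := @poisson_noVoid_tendsto
  have _h₄₅ := @stub_transportCoupling
  -- lead c3, wave 2 (S3b bricks: uniform C² package for univalent maps on compacts; pulled-back cells
  -- are small where Euclidean cells are small) and the Literature FKG layer for Poisson counts: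
  have _h₄₆ := @holo_uniform_bounds
  have _h₄₇ := @hNearest_dist_le
  -- lead c3, wave 3: the family-transport brick of the S3b re-cut, LANDED (a registered skeleton stub):
  have _h₄₈ := @stub_attachmentImage
  -- lead c3, wave 3 (cont.): locality of the homogeneous graph event (registered skeleton stub, LANDED);
  -- measurability of graphCross; continuum ⇒ graph crossing on the no-void condition:
  have _h₄₉ := @stub_graphRestrict
  have _h₅₀ := @measurableSet_graphCross
  have _h₅₁ := @crossEvent_subset_graphCross_of_noVoid
  -- lead c3: S3b-iii, the graph law identity (registered skeleton stub, LANDED p158157), and the easy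
  -- half of S3b-ii (continuum ⇒ graph crossing up to o(1), p158230):
  have _h₅₂ := @stub_graphLaw
  have _h₅₃ := @crossProb_le_graphCross_eventually
  -- lead c3, wave 4 (S3b-i bricks, BS98 §9): Delaunay chains along segments, the (9.1) pivotal
  -- recolouring, the union law `lawBW μ ↦ poissonLaw (2μ)`; and the Literature named fact
  -- `harrisFKG` (FKG for Poisson processes; layers 1, 2a, 2b-α landed, discharge in progress):
  have _h₅₄ := @delaunayChain_along_segment
  have _h₅₅ := @graphCross_pivotal_recolour
  have _h₅₆ := @lawBW_map_union
  have _h₅₇ := Literature.Analysis.FunctionSpaces.IsPoissonPointProcess.harrisFKG.{0}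
  -- lead c3, waves 5–6: the named fact harrisFKG DISCHARGED (p160723), independence of disjoint
  -- restrictions (p161298); the one-arm named fact of the re-planned S3b-i:
  have _h₅₈ := @Literature.Analysis.FunctionSpaces.IsPoissonPointProcess.harrisFKG_holds.{0}
  have _h₅₉ := @Literature.Analysis.FunctionSpaces.IsPoissonPointProcess.indepFun_restrict.{0}
  have _h₆₀ := Literature.Probability.Percolation.VoronoiAnnealedOneArm
  trivial

end Summit.CriticalPhenomena.CardyFormulaZ2.Cruxes.VoronoiHubFromSmirnov.MoebiusExactDelaunayDilationWard

end
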